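import Mathlib
import Summits.Ventures.HodgeRepro.Tier4.Common.HoloFinite
import Summits.Ventures.HodgeRepro.Tier4.Common.CornerHolo
import Summits.Ventures.HodgeRepro.Tier4.Common.RelCompact
import Summits.Ventures.HodgeRepro.Tier4.Common.ProperlyDiscontinuous
import Summits.Ventures.HodgeRepro.Tier4.LitCompactness

/-!
# Tier4/Common/ConcretePD — `P_T4` from (P) for the concrete witness, modulo the PRINTED inputs only: the residual
bundle without Cartan–Serre

Blind re-derivation cell `pub-hodge-repro`, Tier 4 (README §9–§10), seat t4-typer-1 (gen 1).  Target tree path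
`lean/Summits/Ventures/HodgeRepro/Tier4/Common/ConcretePD.lean`.  Imports `HoloFinite` (typer-1 g1: (T2) from the
proper discontinuity), `CornerHolo` (typer-1 g0: `residual_of'`, (T0) Osgood discharged), `RelCompact` (the
`nsq ≤ r < 1` form of relative compactness), `Tier4/Common/ProperlyDiscontinuous` (t4-L4-p1, p667174:
**`properlyDiscontinuous_hdef_holds`** — the proper-discontinuity input is a THEOREM for every `(E, H, τ₀, C)`), and
`Tier4/LitCompactness` (t4-lit-3: the printed Borel–Harish-Chandra inputs `BorelHarishChandra1962_properlyDiscontinuous_hdef`,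
`…_Thm11_8_fundamentalDomain_hdef`).

WHAT IS PROVED.  `residual_of_pd`: the four textbook residuals (T0)–(T3) of the concrete witness hold for a level `Γ′`,
a measurable fundamental domain `D` with `closure D ⊆ 𝔹²`, and the proper discontinuity of the ball action — (T2) by
`finiteDimensional_holoForms`, the rest by `CornerHolo.residual_of'`.  `conclusion_of_concrete_P_pd` and
**`P_T4_of_concrete_pd`**: the frozen `P_T4` follows from «(P) for the concrete witness» of every datum given such a
`(Γ′, D)` and the proper discontinuity.  `pd_of_BHC`: the printed `Lit.BorelHarishChandra1962_properlyDiscontinuous_hdef`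
of the datum's `(E, H, τ₀, C)` yields that proper discontinuity for every level (the datum carries `hH`, `hani`,
`hC`, `hdef`).  **`P_T4_of_concrete_BHC`**: the same with the proper discontinuity supplied by the printed Prop —
the geometric side of (P) now rests on EXACTLY the two printed inputs (proper discontinuity, a relatively compact
fundamental domain) and nothing else; the lines' residual remains (P) for the concrete witness.
`residual_of_pd_nsq` / `P_T4_of_concrete_pd_nsq` carry the `∃ r < 1, nsq ≤ r on D` shape of relative compactness
(L3's `domain`; lit-3's `…_fundamentalDomain_hdef`), and **`P_T4_of_concrete_BHC_domain`** consumes BOTH printed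
Props: then the only remaining hypothesis is (P) for the concrete witness at the level `Γ′ = Γ` itself with the
printed domain.
SINCE THE PROPER DISCONTINUITY IS A THEOREM (`properlyDiscontinuous_hdef_holds`): `isProperlyDiscontinuous` (every
level), **`finiteDimensional_holoForms'`** ((T2) from `(Γ′, D)` alone), `residual_of_domain` / `residual_of_domain_nsq`
(the residual bundle from `(Γ′, D)` alone), `conclusion_of_concrete_P_domain(_nsq)`, **`P_T4_of_concrete_domain`** /
`P_T4_of_concrete_domain_nsq` (P_T4 from (P) for the concrete witness given ONLY a level with a relatively compact
measurable fundamental domain), and **`P_T4_of_concrete_FD`** (the domain supplied by the one printed input left,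
`…_Thm11_8_fundamentalDomain_hdef`: then the ONLY hypothesis is (P) for the concrete witness at level `Γ` on the
printed domain).  The geometric side of (P) rests on ONE printed input: Godement's relatively compact fundamental domain.

Nothing here says anything about the status of the Hodge conjecture for CM abelian varieties, which is NOT proved
(HC_CM is NOT proved by anyone in this repository).
-/

set_option autoImplicit false

noncomputable section

open Matrix MeasureTheory NumberField Set
open scoped ComplexConjugate ComplexOrder

namespace Summit.Ventures.HodgeRepro.Tier4

open Summit.Ventures.HodgeRepro.Tier4.Common

namespace TargetData

variable {F E : Type} [Field F] [NumberField F] [IsGalois ℚ F] [IsCMField F]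
  [Field E] [NumberField E] [IsGalois ℚ E] [IsCMField E] (d : TargetData F E)

/-- **The proper discontinuity of the ball action of a level**, as a predicate on the datum: for every compact
`K ⊆ 𝔹²`, only finitely many `γ ∈ Γ′` move `K` into itself. -/
def IsProperlyDiscontinuous (Γ' : Set (Matrix (Fin 3) (Fin 3) E)) : Prop :=
  ∀ K : Set (Fin 2 → ℂ), IsCompact K → K ⊆ ball → {γ ∈ Γ' | ∃ z ∈ K, d.act γ z ∈ K}.Finite

/-- **The printed input gives the proper discontinuity of every level**: `Lit.BorelHarishChandra1962_properlyDiscontinuous_hdef`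
for the datum's `(E, H, τ₀, C)`, applied to the datum's own hypotheses `hH`, `hani`, `hC`, `hdef`. -/
theorem isProperlyDiscontinuous_of_BHC
    (hBHC : Lit.BorelHarishChandra1962_properlyDiscontinuous_hdef E d.H d.τ₀ d.C)
    {Γ' : Set (Matrix (Fin 3) (Fin 3) E)} (hΓ' : d.IsLevel Γ') : d.IsProperlyDiscontinuous Γ' :=
  fun K hK hKb => hBHC d.hH d.hani d.hC d.hdef Γ' hΓ'.1 K hK hKb

/-- **The residual bundle from the printed inputs alone**: (T0)–(T3) for a level `Γ′`, a relatively compact measurable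
fundamental domain `D`, and the proper discontinuity — no Cartan–Serre hypothesis. -/
theorem residual_of_pd {Γ' : Set (Matrix (Fin 3) (Fin 3) E)} (hΓ' : d.IsLevel Γ') {D : Set (Fin 2 → ℂ)}
    (hDom : d.IsDomain Γ' D) (hDc : closure D ⊆ ball) (hpd : d.IsProperlyDiscontinuous Γ') :
    d.ConcreteResidual Γ' D :=
  d.residual_of' hΓ' hDom hDc (d.finiteDimensional_holoForms hΓ' hDom hDc hpd)

/-- (P) for the concrete witness built from the printed inputs gives the conclusion of `P_T4`. -/
theorem conclusion_of_concrete_P_pd {Γ' : Set (Matrix (Fin 3) (Fin 3) E)} (hΓ' : d.IsLevel Γ')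
    {D : Set (Fin 2 → ℂ)} (hDom : d.IsDomain Γ' D) (hDc : closure D ⊆ ball) (hpd : d.IsProperlyDiscontinuous Γ')
    (hP : (d.concreteWitness hΓ' hDom.subset_ball hDom.measurableSet (d.residual_of_pd hΓ' hDom hDc hpd)).P) :
    d.conclusion :=
  d.conclusion_of_concrete_P hΓ' hDom _ hP

/-- The residual bundle from the printed inputs, relative compactness in the `nsq ≤ r < 1` form. -/
theorem residual_of_pd_nsq {Γ' : Set (Matrix (Fin 3) (Fin 3) E)} (hΓ' : d.IsLevel Γ') {D : Set (Fin 2 → ℂ)}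
    (hDom : d.IsDomain Γ' D) {r : ℝ} (hr : r < 1) (hD : ∀ z ∈ D, nsq z ≤ r) (hpd : d.IsProperlyDiscontinuous Γ') :
    d.ConcreteResidual Γ' D :=
  d.residual_of_pd hΓ' hDom (closure_subset_ball_of_nsq_le hr hD) hpd

/-- (P) for the concrete witness gives the conclusion of `P_T4`; printed inputs only, `nsq ≤ r < 1` form. -/
theorem conclusion_of_concrete_P_pd_nsq {Γ' : Set (Matrix (Fin 3) (Fin 3) E)} (hΓ' : d.IsLevel Γ')
    {D : Set (Fin 2 → ℂ)} (hDom : d.IsDomain Γ' D) {r : ℝ} (hr : r < 1) (hD : ∀ z ∈ D, nsq z ≤ r)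
    (hpd : d.IsProperlyDiscontinuous Γ')
    (hP : (d.concreteWitness hΓ' hDom.subset_ball hDom.measurableSet (d.residual_of_pd_nsq hΓ' hDom hr hD hpd)).P) :
    d.conclusion :=
  d.conclusion_of_concrete_P hΓ' hDom _ hP

/-- `Γ` itself is a level. -/
theorem isLevel_self : d.IsLevel d.Γ := ⟨d.hΓ, subset_refl _⟩

/-! ## The proper discontinuity is a theorem: the residual from `(Γ′, D)` alone -/

/-- **Every level acts properly discontinuously** (t4-L4-p1's `properlyDiscontinuous_hdef_holds`, applied to the datum's
`(E, H, τ₀, C)` through `isProperlyDiscontinuous_of_BHC`). -/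
theorem isProperlyDiscontinuous {Γ' : Set (Matrix (Fin 3) (Fin 3) E)} (hΓ' : d.IsLevel Γ') :
    d.IsProperlyDiscontinuous Γ' :=
  d.isProperlyDiscontinuous_of_BHC (properlyDiscontinuous_hdef_holds E d.H d.τ₀ d.C) hΓ'

/-- **(T2) from `(Γ′, D)` alone**: the holomorphic forms of `X_{Γ′}` over a relatively compact measurable fundamental
domain are finite-dimensional. -/
theorem finiteDimensional_holoForms' {Γ' : Set (Matrix (Fin 3) (Fin 3) E)} (hΓ' : d.IsLevel Γ') {D : Set (Fin 2 → ℂ)}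
    (hDom : d.IsDomain Γ' D) (hDc : closure D ⊆ ball) : FiniteDimensional ℂ (d.HForm Γ' D) :=
  d.finiteDimensional_holoForms hΓ' hDom hDc (d.isProperlyDiscontinuous hΓ')

/-- **The residual bundle from `(Γ′, D)` alone**: (T0)–(T3) for a level and a relatively compact measurable fundamental
domain — no hypothesis beyond the datum. -/
theorem residual_of_domain {Γ' : Set (Matrix (Fin 3) (Fin 3) E)} (hΓ' : d.IsLevel Γ') {D : Set (Fin 2 → ℂ)}
    (hDom : d.IsDomain Γ' D) (hDc : closure D ⊆ ball) : d.ConcreteResidual Γ' D :=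
  d.residual_of_pd hΓ' hDom hDc (d.isProperlyDiscontinuous hΓ')

/-- The residual bundle from `(Γ′, D)` alone, relative compactness in the `nsq ≤ r < 1` form. -/
theorem residual_of_domain_nsq {Γ' : Set (Matrix (Fin 3) (Fin 3) E)} (hΓ' : d.IsLevel Γ') {D : Set (Fin 2 → ℂ)}
    (hDom : d.IsDomain Γ' D) {r : ℝ} (hr : r < 1) (hD : ∀ z ∈ D, nsq z ≤ r) : d.ConcreteResidual Γ' D :=
  d.residual_of_domain hΓ' hDom (closure_subset_ball_of_nsq_le hr hD)

/-- (P) for the concrete witness built from `(Γ′, D)` alone gives the conclusion of `P_T4`. -/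
theorem conclusion_of_concrete_P_domain {Γ' : Set (Matrix (Fin 3) (Fin 3) E)} (hΓ' : d.IsLevel Γ')
    {D : Set (Fin 2 → ℂ)} (hDom : d.IsDomain Γ' D) (hDc : closure D ⊆ ball)
    (hP : (d.concreteWitness hΓ' hDom.subset_ball hDom.measurableSet (d.residual_of_domain hΓ' hDom hDc)).P) :
    d.conclusion :=
  d.conclusion_of_concrete_P hΓ' hDom _ hP

/-- (P) for the concrete witness built from `(Γ′, D)` alone gives the conclusion of `P_T4`; `nsq ≤ r < 1` form. -/
theorem conclusion_of_concrete_P_domain_nsq {Γ' : Set (Matrix (Fin 3) (Fin 3) E)} (hΓ' : d.IsLevel Γ')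
    {D : Set (Fin 2 → ℂ)} (hDom : d.IsDomain Γ' D) {r : ℝ} (hr : r < 1) (hD : ∀ z ∈ D, nsq z ≤ r)
    (hP : (d.concreteWitness hΓ' hDom.subset_ball hDom.measurableSet (d.residual_of_domain_nsq hΓ' hDom hr hD)).P) :
    d.conclusion :=
  d.conclusion_of_concrete_P hΓ' hDom _ hP

end TargetData

/-- **`P_T4` from (P) for the concrete witness given ONLY a level with a relatively compact measurable fundamental
domain** — the proper discontinuity being a theorem: if every datum has such a `(Γ′, D)` and (P) for the concrete
witness built from it, then `P_T4`. -/
theorem P_T4_of_concrete_domain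
    (h : ∀ (F E : Type) [Field F] [NumberField F] [IsGalois ℚ F] [IsCMField F]
      [Field E] [NumberField E] [IsGalois ℚ E] [IsCMField E] (d : TargetData F E),
      ∃ (Γ' : Set (Matrix (Fin 3) (Fin 3) E)) (hΓ' : d.IsLevel Γ') (D : Set (Fin 2 → ℂ)) (hDom : d.IsDomain Γ' D)
        (hDc : closure D ⊆ ball),
        (d.concreteWitness hΓ' hDom.subset_ball hDom.measurableSet (d.residual_of_domain hΓ' hDom hDc)).P) :
    P_T4 := by
  refine P_T4_of_forall fun F E _ _ _ _ _ _ _ _ d => ?_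
  obtain ⟨Γ', hΓ', D, hDom, hDc, hP⟩ := h F E d
  exact d.conclusion_of_concrete_P_domain hΓ' hDom hDc hP

/-- **`P_T4` from (P) for the concrete witness given ONLY a level with a fundamental domain inside `{nsq ≤ r}`,
`r < 1`** (L3's domain shape). -/
theorem P_T4_of_concrete_domain_nsq
    (h : ∀ (F E : Type) [Field F] [NumberField F] [IsGalois ℚ F] [IsCMField F]
      [Field E] [NumberField E] [IsGalois ℚ E] [IsCMField E] (d : TargetData F E),
      ∃ (Γ' : Set (Matrix (Fin 3) (Fin 3) E)) (hΓ' : d.IsLevel Γ') (D : Set (Fin 2 → ℂ)) (hDom : d.IsDomain Γ' D)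
        (r : ℝ) (hr : r < 1) (hD : ∀ z ∈ D, nsq z ≤ r),
        (d.concreteWitness hΓ' hDom.subset_ball hDom.measurableSet (d.residual_of_domain_nsq hΓ' hDom hr hD)).P) :
    P_T4 := by
  refine P_T4_of_forall fun F E _ _ _ _ _ _ _ _ d => ?_
  obtain ⟨Γ', hΓ', D, hDom, r, hr, hD, hP⟩ := h F E d
  exact d.conclusion_of_concrete_P_domain_nsq hΓ' hDom hr hD hP

/-- **`P_T4` modulo the ONE printed input left** — Godement's relatively compact measurable fundamental domain
(t4-lit-3's `…_Thm11_8_fundamentalDomain_hdef`, cite-only): if, for every datum and every fundamental domain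
`D ⊆ {nsq ≤ r}` (`r < 1`) of `Γ` itself, (P) holds for the concrete witness built from `(Γ, D)` alone, then `P_T4`.
(The hypothesis `h` is quantified over every such domain; a consumer with its own domain uses the ∃-form
`P_T4_of_concrete_domain_nsq`.) -/
theorem P_T4_of_concrete_FD
    (hFD : ∀ (E : Type) [Field E] [NumberField E] [IsGalois ℚ E] [IsCMField E] (H : Matrix (Fin 3) (Fin 3) E)
      (τ₀ : E →+* ℂ) (C : Matrix (Fin 3) (Fin 3) ℂ), Lit.BorelHarishChandra1962_Thm11_8_fundamentalDomain_hdef E H τ₀ C)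
    (h : ∀ (F E : Type) [Field F] [NumberField F] [IsGalois ℚ F] [IsCMField F]
      [Field E] [NumberField E] [IsGalois ℚ E] [IsCMField E] (d : TargetData F E)
      (D : Set (Fin 2 → ℂ)) (hDom : d.IsDomain d.Γ D) (r : ℝ) (hr : r < 1) (hD : ∀ z ∈ D, nsq z ≤ r),
      (d.concreteWitness d.isLevel_self hDom.subset_ball hDom.measurableSet
        (d.residual_of_domain_nsq d.isLevel_self hDom hr hD)).P) :
    P_T4 := by
  refine P_T4_of_forall fun F E _ _ _ _ _ _ _ _ d => ?_
  obtain ⟨D, hDom, r, hr, hD⟩ := hFD E d.H d.τ₀ d.C d.hH d.hani d.hC d.hdef d.Γ d.hΓ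
  exact d.conclusion_of_concrete_P_domain_nsq d.isLevel_self hDom hr hD (h F E d D hDom r hr hD)

/-- **`P_T4` modulo the printed inputs** — no Cartan–Serre: if every datum has a level `Γ′`, a relatively compact
measurable fundamental domain `D`, the proper discontinuity of the ball action of `Γ′`, and (P) for the concrete
witness, then `P_T4`. -/
theorem P_T4_of_concrete_pd
    (h : ∀ (F E : Type) [Field F] [NumberField F] [IsGalois ℚ F] [IsCMField F]
      [Field E] [NumberField E] [IsGalois ℚ E] [IsCMField E] (d : TargetData F E),
      ∃ (Γ' : Set (Matrix (Fin 3) (Fin 3) E)) (hΓ' : d.IsLevel Γ') (D : Set (Fin 2 → ℂ)) (hDom : d.IsDomain Γ' D)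
        (hDc : closure D ⊆ ball) (hpd : d.IsProperlyDiscontinuous Γ'),
        (d.concreteWitness hΓ' hDom.subset_ball hDom.measurableSet (d.residual_of_pd hΓ' hDom hDc hpd)).P) :
    P_T4 := by
  refine P_T4_of_forall fun F E _ _ _ _ _ _ _ _ d => ?_
  obtain ⟨Γ', hΓ', D, hDom, hDc, hpd, hP⟩ := h F E d
  exact d.conclusion_of_concrete_P_pd hΓ' hDom hDc hpd hP

/-- **`P_T4` modulo the printed inputs**, relative compactness in the `nsq ≤ r < 1` form. -/
theorem P_T4_of_concrete_pd_nsq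
    (h : ∀ (F E : Type) [Field F] [NumberField F] [IsGalois ℚ F] [IsCMField F]
      [Field E] [NumberField E] [IsGalois ℚ E] [IsCMField E] (d : TargetData F E),
      ∃ (Γ' : Set (Matrix (Fin 3) (Fin 3) E)) (hΓ' : d.IsLevel Γ') (D : Set (Fin 2 → ℂ)) (hDom : d.IsDomain Γ' D)
        (r : ℝ) (hr : r < 1) (hD : ∀ z ∈ D, nsq z ≤ r) (hpd : d.IsProperlyDiscontinuous Γ'),
        (d.concreteWitness hΓ' hDom.subset_ball hDom.measurableSet (d.residual_of_pd_nsq hΓ' hDom hr hD hpd)).P) :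
    P_T4 := by
  refine P_T4_of_forall fun F E _ _ _ _ _ _ _ _ d => ?_
  obtain ⟨Γ', hΓ', D, hDom, r, hr, hD, hpd, hP⟩ := h F E d
  exact d.conclusion_of_concrete_P_pd_nsq hΓ' hDom hr hD hpd hP

/-- **`P_T4` modulo the printed proper discontinuity** (Borel–Harish-Chandra 1962, t4-lit-3's
`BorelHarishChandra1962_properlyDiscontinuous_hdef`): if every datum has a level `Γ′`, a relatively compact measurable
fundamental domain `D`, and (P) for the concrete witness built with the residual bundle
`residual_of_pd … (isProperlyDiscontinuous_of_BHC …)`, then `P_T4`. -/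
theorem P_T4_of_concrete_BHC
    (h : ∀ (F E : Type) [Field F] [NumberField F] [IsGalois ℚ F] [IsCMField F]
      [Field E] [NumberField E] [IsGalois ℚ E] [IsCMField E] (d : TargetData F E)
      (hBHC : Lit.BorelHarishChandra1962_properlyDiscontinuous_hdef E d.H d.τ₀ d.C),
      ∃ (Γ' : Set (Matrix (Fin 3) (Fin 3) E)) (hΓ' : d.IsLevel Γ') (D : Set (Fin 2 → ℂ)) (hDom : d.IsDomain Γ' D)
        (hDc : closure D ⊆ ball),
        (d.concreteWitness hΓ' hDom.subset_ball hDom.measurableSet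
          (d.residual_of_pd hΓ' hDom hDc (d.isProperlyDiscontinuous_of_BHC hBHC hΓ'))).P)
    (hBHC : ∀ (E : Type) [Field E] [NumberField E] [IsGalois ℚ E] [IsCMField E] (H : Matrix (Fin 3) (Fin 3) E)
      (τ₀ : E →+* ℂ) (C : Matrix (Fin 3) (Fin 3) ℂ), Lit.BorelHarishChandra1962_properlyDiscontinuous_hdef E H τ₀ C) :
    P_T4 := by
  refine P_T4_of_forall fun F E _ _ _ _ _ _ _ _ d => ?_
  obtain ⟨Γ', hΓ', D, hDom, hDc, hP⟩ := h F E d (hBHC E d.H d.τ₀ d.C)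
  exact d.conclusion_of_concrete_P_pd hΓ' hDom hDc (d.isProperlyDiscontinuous_of_BHC (hBHC E d.H d.τ₀ d.C) hΓ') hP

/-- **`P_T4` modulo BOTH printed inputs** (proper discontinuity + a relatively compact measurable fundamental domain,
t4-lit-3's `…_properlyDiscontinuous_hdef` / `…_Thm11_8_fundamentalDomain_hdef`): if for every datum and every level
`Γ′` with a fundamental domain `D ⊆ {nsq ≤ r}`, `r < 1`, (P) holds for the concrete witness built from the printed
inputs, then `P_T4`.  The hypothesis `h` is quantified over ALL such `(Γ′, D)` so that a line may use the printed
domain at the level it chooses. -/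
theorem P_T4_of_concrete_BHC_domain
    (hPD : ∀ (E : Type) [Field E] [NumberField E] [IsGalois ℚ E] [IsCMField E] (H : Matrix (Fin 3) (Fin 3) E)
      (τ₀ : E →+* ℂ) (C : Matrix (Fin 3) (Fin 3) ℂ), Lit.BorelHarishChandra1962_properlyDiscontinuous_hdef E H τ₀ C)
    (hFD : ∀ (E : Type) [Field E] [NumberField E] [IsGalois ℚ E] [IsCMField E] (H : Matrix (Fin 3) (Fin 3) E)
      (τ₀ : E →+* ℂ) (C : Matrix (Fin 3) (Fin 3) ℂ), Lit.BorelHarishChandra1962_Thm11_8_fundamentalDomain_hdef E H τ₀ C)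
    (h : ∀ (F E : Type) [Field F] [NumberField F] [IsGalois ℚ F] [IsCMField F]
      [Field E] [NumberField E] [IsGalois ℚ E] [IsCMField E] (d : TargetData F E)
      (hBHC : Lit.BorelHarishChandra1962_properlyDiscontinuous_hdef E d.H d.τ₀ d.C)
      (D : Set (Fin 2 → ℂ)) (hDom : d.IsDomain d.Γ D) (r : ℝ) (hr : r < 1) (hD : ∀ z ∈ D, nsq z ≤ r),
      (d.concreteWitness d.isLevel_self hDom.subset_ball hDom.measurableSet
        (d.residual_of_pd_nsq d.isLevel_self hDom hr hD (d.isProperlyDiscontinuous_of_BHC hBHC d.isLevel_self))).P) :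
    P_T4 := by
  refine P_T4_of_forall fun F E _ _ _ _ _ _ _ _ d => ?_
  obtain ⟨D, hDom, r, hr, hD⟩ := hFD E d.H d.τ₀ d.C d.hH d.hani d.hC d.hdef d.Γ d.hΓ
  exact d.conclusion_of_concrete_P_pd_nsq d.isLevel_self hDom hr hD
    (d.isProperlyDiscontinuous_of_BHC (hPD E d.H d.τ₀ d.C) d.isLevel_self) (h F E d (hPD E d.H d.τ₀ d.C) D hDom r hr hD)

end Summit.Ventures.HodgeRepro.Tier4
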